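/-
Copyright (c) 2026 the pub-hodgecm-mathlib formalisation cell (harness21).  Prover seat hodgecm-mathlib-LH4-p06 (g9), req620 Track A «(D-RAM) FOUR-FRAME» squad
F0∕P3c∕LH4; the (β₂) road (R-36) «PURE-CELL LEDGER», β₂-BOARD v2 row (ROW), β₂ WORDS #13∕#16 of the sub-dealer LH4-p04 (g9): pieces (ROW-PURE-D) ∕ (ROW-REL-CLEAN)
«EVERY CLEAN-REGIME ROW CELL IS PURE» — the SHELL half (per vertex); helper lane on h413 = stmt-HodgeConjecture-24833 (count-neutral).  2026-09-04.
-/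
import Summits.HodgeConjecture.HodgeConjecture.Theorems.F0P3cDyRamDeepConeCellOffShell   -- ★ p862651 (LH7-p09 (g2)): brings ★ p862572 `mul_map_sub_mul_map_eq`, ★ `…ShellLineModel`, ★ p861810 `v_map_le_map_pow_of_le`, ★ DEFS
import HarnessLib

/-!
# Crux `H413`, line LH4 «(D-RAM) FOUR-FRAME» — the (β₂) road (R-36), row (ROW) of β₂-BOARD v2: «A ROW VERTEX STRICTLY INSIDE THE ANTI-DIAGONAL IS ON THE `ℓ₀ = 0` SHELL» —
# on the diagonal row `|lam − jE u₀₀| = |ϖE|^{2b}` and strictly inside the anti-diagonal (`|μ − ρμ| ≤ |cc(α − ρα)|·|ϖE|^{b+1}`) EVERY glued vertex `L` of the cone cell has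
# `(Γ − 1)·L ⊆ L`, `(Γ − 1)·L ⊄ ϖ·L`, and `(Γ − 1)²·L ⊆ ϖ^k·L` for every square level `k ≤ 2b` inside the `u`-precision (`k ≤ 2n_u`, `k ≤ b + 1 + n_u`, `k ≤ t + n_u`) — any `q`

Cell `hodgecm-mathlib` (D-0151), FLOOR 0, crux item H413 = `stmt-HodgeConjecture-24833`, route of record `HCCMUnconditional`; squad F0∕P3c∕LH4; lane
`--supports stmt-HodgeConjecture-24833 --as helper` (count-neutral; pays NO tier-0 row).  THEOREMS ONLY (no `def`, no instance, no notation, no `sorry`, default heartbeats);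
★-only imports; states NO law; (β₂) stays a HYPOTHESIS.  DATUM-FREE: ★ `…ShellLineModel`'s glued-vertex frame VERBATIM, the cell's order letters (`hYO hYprim hYb hcb`) and
SIZE tokens only (`|2| ≤ |ϖ|^t` is a letter `h2`).  WHY (β₂ WORDS #13∕#16 of the sub-dealer LH4-p04 (g9), pieces (ROW-PURE-D)∕(ROW-REL-CLEAN); mirror image of ★ p862651
DEEP ∕ ★ p862855 TOP): a PURE cell needs every vertex ON both shells `(ℓ₀, m*)`, `(ℓ₀, m_c)`; by ★ `latticeNearTransvShell_endoGL_sub_one_iff_isOrd` the shell token at depth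
`0`, square level `k` is seven order clauses in `𝒪_cc`, decided on the ROW by size through the `Fix ρ`-coordinates of ★ p862572 (`μρY − Yρμ = (BP − AQ)(α − ρα)`):
§1 `isOrd_div_of_row` (`μ∕Y ∈ 𝒪_cc`), `not_isOrd_div_mul_of_row` (`μ∕(ϖE·Y) ∉ 𝒪_cc`: with `|μ| = |ϖE|^{2b}` EXACT and Gram-primitivity the coordinate `A·Q` dominates strictly);
§2 `isOrd_sub_one_of_row`; §3 the square clauses `isOrd_sq_div_of_row`, `isOrd_sqDiff_div_of_row` (`(lam − 1)² − (jE u₀₀ − 1)² = μ·(μ + 2(jE u₀₀ − 1))`, `|2| ≤ |ϖ|^t`);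
§4 HEAD `latticeNearTransvShell_zero_of_row`.  AT THE RECORD (`d` even, `n_u = m* = 2d − 1`, `t ≥ d − 1`): `k ∈ {m*, m_c = 3d − 2}` qualify once `2b = m ≥ 3d − 2` (★ p861813's
fence).  NOT CLAIMED: the letter of the vertex (★ p862848), the cell-level purity (sibling file), anything at `d` odd (the `2b = m` row is off the depth-`1` shell, ★ p862651).
HONEST LABEL.  Count-neutral order algebra; nothing printed is asserted; no census law is stated; `HC_CM` is proved only modulo the 7 printed citations (2 remaining named
inputs: hLiu418 = `stmt-HodgeConjecture-24832`, h413 = `stmt-HodgeConjecture-24833`) until rung 0 closes.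
## References
* [Kottwitz1986BaseChangeUnits] R. E. Kottwitz, Compositio Math. 60 (1986): §1 pp. 240–241, §3; [Serre1979] J.-P. Serre, *Local Fields*, GTM 67 (1979): Ch. III §6 Prop. 12;
  [Jacobowitz1962] R. Jacobowitz, Amer. J. Math. 84 (1962): §4; [Rogawski1990] J. D. Rogawski, Ann. of Math. Stud. 123 (1990): §4.9 Prop. 4.9.1 (b) p. 55.
-/

set_option autoImplicit false

noncomputable section

namespace Summit.HodgeConjecture.HodgeConjecture.Cruxes.H413.F0P3cDyRamRowCellOnShell

open scoped Valued WithZero Matrix MatrixGroups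
open WithZero
open Literature.NumberTheory.Automorphic Literature.NumberTheory.Automorphic.HermitianLattice Literature.NumberTheory.Automorphic.UnitaryLatticeTree
open Literature.NumberTheory.Rogawski1990
open Summit.HodgeConjecture.HodgeConjecture.Cruxes.H413.F0P3cDyRamToricCensusDefs
open Summit.HodgeConjecture.HodgeConjecture.Cruxes.H413.F0P3cDyRamFourFrameCensusDefs (LatticeInLevel LatticeNearTransvShell)
open Summit.HodgeConjecture.HodgeConjecture.Cruxes.H413.F0P3cDyRamShellLineModel (latticeNearTransvShell_endoGL_sub_one_iff_isOrd)
open Summit.HodgeConjecture.HodgeConjecture.Cruxes.H413.F0P3cDyRamBoundaryCellLetterCardTwo (v_map_lt_one_iff_of_le_iff)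
open Summit.HodgeConjecture.HodgeConjecture.Cruxes.H413.F0P3cDyRamRayDominatedCellLetter (v_map_le_map_pow_of_le)
open Summit.HodgeConjecture.HodgeConjecture.Cruxes.H413.F0P3cDyRamTerminalCellOffShellCardTwo (mul_map_sub_mul_map_eq)

variable {E M : Type} [Field E] [Valued E ℤᵐ⁰] [Field M] [Valued M ℤᵐ⁰] {ρ : M →+* M} {α : M}

/-! ## §0 Uniformiser letters -/

/-- The uniformiser letters used throughout: `ϖ ≠ 0`, `|ϖ| < 1`, `jE ϖ ≠ 0`, `|jE ϖ| ≠ 0`, `0 < |jE ϖ| < 1`, `|jE ϖ| ≤ 1` (`|ϖ| = exp(−1)`, `|jE c| ≤ 1 ↔ |c| ≤ 1`).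
[cite: Serre1979, Ch. III §6 Prop. 12] -/
theorem uniformizer_letters (jE : E →+* M) (hjv : ∀ c, Valued.v (jE c) ≤ 1 ↔ Valued.v c ≤ 1) {ϖ : E} (hϖ : Valued.v ϖ = exp (-1 : ℤ)) :
    ϖ ≠ 0 ∧ Valued.v ϖ < 1 ∧ jE ϖ ≠ 0 ∧ Valued.v (jE ϖ) ≠ 0 ∧ 0 < Valued.v (jE ϖ) ∧ Valued.v (jE ϖ) < 1 ∧ Valued.v (jE ϖ) ≤ 1 := by
  have hvϖ0 : Valued.v ϖ ≠ 0 := by rw [hϖ]; exact exp_ne_zero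
  have hϖ0 : ϖ ≠ 0 := fun h0 => hvϖ0 (by rw [h0, map_zero])
  have hϖlt : Valued.v ϖ < 1 := by rw [hϖ, ← exp_zero, exp_lt_exp]; norm_num
  have hvjϖ0 : Valued.v (jE ϖ) ≠ 0 := (Valuation.ne_zero_iff _).2 ((map_ne_zero jE).2 hϖ0)
  have hjϖlt : Valued.v (jE ϖ) < 1 := (v_map_lt_one_iff_of_le_iff jE hjv ϖ).2 hϖlt
  exact ⟨hϖ0, hϖlt, (map_ne_zero jE).2 hϖ0, hvjϖ0, zero_lt_iff.2 hvjϖ0, hjϖlt, hjϖlt.le⟩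

/-! ## §1 The depth quotient of a row vertex: in the order, and exactly there -/

/-- **ROW ⇒ THE DEPTH QUOTIENT IS IN THE ORDER (any `q`).**  Line model: `ρ` isometric, `ρα ≠ α`, `|α| ≤ 1`, `|ϖ| = exp(−1)`, `|jE c| ≤ 1 ↔ |c| ≤ 1`.  CELL: `Y ∈ 𝒪_cc`,
`|Y| = |ϖE|^b`, `|cc| ≤ |ϖE|^b`.  ROW letters: `|μ| ≤ |ϖE|^{2b}` and `|μ − ρμ| ≤ |cc(α − ρα)|·|ϖE|^b` (inside the anti-diagonal).  THEN `IsOrd ρ α cc (μ ∕ Y)`.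
[cite: Serre1979, Ch. III §6 Prop. 12] [cite: Kottwitz1986BaseChangeUnits, §1 pp. 240–241] -/
theorem isOrd_div_of_row
    (hvρ : ∀ x, Valued.v (ρ x) = Valued.v x) (hα : ρ α ≠ α) (hα1 : Valued.v α ≤ 1)
    (jE : E →+* M) (hjv : ∀ c, Valued.v (jE c) ≤ 1 ↔ Valued.v c ≤ 1) {ϖ : E} (hϖ : Valued.v ϖ = exp (-1 : ℤ))
    {cc : M} {Y : M} (hYO : IsOrd ρ α cc Y) {b : ℕ} (hYb : Valued.v Y = Valued.v (jE ϖ) ^ b) (hcb : Valued.v cc ≤ Valued.v (jE ϖ) ^ b)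
    {μ : M} (hμ : Valued.v μ ≤ Valued.v (jE ϖ) ^ (2 * b)) (hanti : Valued.v (μ - ρ μ) ≤ Valued.v (cc * (α - ρ α)) * Valued.v (jE ϖ) ^ b) :
    IsOrd ρ α cc (μ / Y) := by
  have hvαpos : 0 < Valued.v (α - ρ α) := zero_lt_iff.2 ((Valuation.ne_zero_iff _).2 (sub_ne_zero.2 (Ne.symm hα)))
  obtain ⟨hϖ0, hϖlt, hjϖ0, hvjϖ0, hvjϖpos, hjϖlt, hjϖle⟩ := uniformizer_letters jE hjv hϖ
  have hY0 : Y ≠ 0 := fun h0 => pow_ne_zero b hvjϖ0 (hYb.symm.trans (by rw [h0, Valuation.map_zero]))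
  have hρY0 : ρ Y ≠ 0 := (map_ne_zero ρ).2 hY0
  -- coordinates over `Fix ρ` (sizes only)
  set B : M := (μ - ρ μ) / (α - ρ α) with hBdef
  set Q : M := (Y - ρ Y) / (α - ρ α) with hQdef
  set A : M := μ - B * α with hAdef
  set P : M := Y - Q * α with hPdef
  clear_value A P B Q
  have hvB : Valued.v B ≤ Valued.v cc * Valued.v (jE ϖ) ^ b := by
    rw [hBdef, Valuation.map_div, div_le_iff₀ hvαpos]
    calc Valued.v (μ - ρ μ) ≤ Valued.v (cc * (α - ρ α)) * Valued.v (jE ϖ) ^ b := hanti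
      _ = Valued.v cc * Valued.v (jE ϖ) ^ b * Valued.v (α - ρ α) := by rw [Valuation.map_mul]; ac_rfl
  have hvQ : Valued.v Q ≤ Valued.v cc := by rw [hQdef, Valuation.map_div, div_le_iff₀ hvαpos, ← Valuation.map_mul]; exact hYO.2
  have hvP : Valued.v P ≤ Valued.v (jE ϖ) ^ b := by
    rw [hPdef]; refine (Valuation.map_sub _ _ _).trans (max_le hYb.le ?_); rw [Valuation.map_mul]
    exact (mul_le_mul' hvQ hα1).trans (by rw [mul_one]; exact hcb)
  have hvA : Valued.v A ≤ Valued.v (jE ϖ) ^ (2 * b) := by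
    rw [hAdef]; refine (Valuation.map_sub _ _ _).trans (max_le hμ ?_); rw [Valuation.map_mul]
    calc Valued.v B * Valued.v α ≤ Valued.v cc * Valued.v (jE ϖ) ^ b * 1 := mul_le_mul' hvB hα1
      _ = Valued.v cc * Valued.v (jE ϖ) ^ b := mul_one _
      _ ≤ Valued.v (jE ϖ) ^ b * Valued.v (jE ϖ) ^ b := mul_le_mul_left hcb _
      _ = Valued.v (jE ϖ) ^ (2 * b) := by rw [← pow_add]; congr 1; omega
  have hBP : Valued.v (B * P) ≤ Valued.v cc * Valued.v (jE ϖ) ^ (2 * b) := by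
    rw [Valuation.map_mul]
    calc Valued.v B * Valued.v P ≤ Valued.v cc * Valued.v (jE ϖ) ^ b * Valued.v (jE ϖ) ^ b := mul_le_mul' hvB hvP
      _ = Valued.v cc * Valued.v (jE ϖ) ^ (2 * b) := by rw [mul_assoc, ← pow_add]; congr 2; omega
  have hAQ : Valued.v (A * Q) ≤ Valued.v cc * Valued.v (jE ϖ) ^ (2 * b) := by rw [Valuation.map_mul, mul_comm]; exact mul_le_mul' hvQ hvA
  have hdiff : Valued.v (B * P - A * Q) ≤ Valued.v cc * Valued.v (jE ϖ) ^ (2 * b) :=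
    (Valuation.map_sub _ _ _).trans (max_le hBP hAQ)
  refine ⟨?_, ?_⟩
  · rw [Valuation.map_div, hYb, div_le_one₀ (pow_pos hvjϖpos _)]
    exact hμ.trans (pow_le_pow_right_of_le_one' hjϖle (by omega))
  · have hident : μ / Y - ρ (μ / Y) = (B * P - A * Q) * (α - ρ α) / (Y * ρ Y) := by
      rw [map_div₀, div_sub_div _ _ hY0 hρY0, mul_map_sub_mul_map_eq hα hBdef hAdef hQdef hPdef]
    rw [hident, Valuation.map_div, Valuation.map_mul, Valuation.map_mul, hvρ, hYb,
      div_le_iff₀ (mul_pos (pow_pos hvjϖpos _) (pow_pos hvjϖpos _))]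
    calc Valued.v (B * P - A * Q) * Valued.v (α - ρ α)
        ≤ Valued.v cc * Valued.v (jE ϖ) ^ (2 * b) * Valued.v (α - ρ α) := mul_le_mul_left hdiff _
      _ = Valued.v (cc * (α - ρ α)) * (Valued.v (jE ϖ) ^ b * Valued.v (jE ϖ) ^ b) := by
          rw [Valuation.map_mul, two_mul, pow_add]; ac_rfl

/-- **ROW ⇒ THE DEPTH QUOTIENT IS NOT ONE DIGIT DEEPER (any `q`).**  Same frame; CELL: `Y ∈ 𝒪_cc` GRAM-PRIMITIVE (`Y∕ϖE ∉ 𝒪_cc`), `|Y| = |ϖE|^b`, `1 ≤ b`, `|cc| ≤ |ϖE|^b`,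
`ρ(ϖE) = ϖE`.  ROW letters: `|μ| = |ϖE|^{2b}` EXACTLY and `|μ − ρμ| ≤ |cc(α − ρα)|·|ϖE|^{b+1}` (STRICTLY inside the anti-diagonal).  THEN `¬ IsOrd ρ α cc (μ ∕ (ϖE·Y))`:
in the `Fix ρ`-coordinates `μρY − Yρμ = (BP − AQ)(α − ρα)` the term `AQ` has `|A| = |ϖE|^{2b}`, `|Q| > |cc|·|ϖE|` and dominates `BP` strictly.
[cite: Serre1979, Ch. III §6 Prop. 12] [cite: Jacobowitz1962, §4] [cite: Kottwitz1986BaseChangeUnits, §3] -/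
theorem not_isOrd_div_mul_of_row
    (hvρ : ∀ x, Valued.v (ρ x) = Valued.v x) (hα : ρ α ≠ α) (hα1 : Valued.v α ≤ 1)
    (jE : E →+* M) (hjv : ∀ c, Valued.v (jE c) ≤ 1 ↔ Valued.v c ≤ 1) {ϖ : E} (hϖ : Valued.v ϖ = exp (-1 : ℤ)) (hρϖ : ρ (jE ϖ) = jE ϖ)
    {cc : M} {Y : M} (hYO : IsOrd ρ α cc Y) (hYprim : ¬ IsOrd ρ α cc (Y / jE ϖ)) {b : ℕ} (hb1 : 1 ≤ b) (hYb : Valued.v Y = Valued.v (jE ϖ) ^ b)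
    (hcb : Valued.v cc ≤ Valued.v (jE ϖ) ^ b)
    {μ : M} (hμ : Valued.v μ = Valued.v (jE ϖ) ^ (2 * b)) (hanti : Valued.v (μ - ρ μ) ≤ Valued.v (cc * (α - ρ α)) * Valued.v (jE ϖ) ^ (b + 1)) :
    ¬ IsOrd ρ α cc (μ / (jE ϖ * Y)) := by
  have hvαpos : 0 < Valued.v (α - ρ α) := zero_lt_iff.2 ((Valuation.ne_zero_iff _).2 (sub_ne_zero.2 (Ne.symm hα)))
  obtain ⟨hϖ0, hϖlt, hjϖ0, hvjϖ0, hvjϖpos, hjϖlt, hjϖle⟩ := uniformizer_letters jE hjv hϖ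
  have hY0 : Y ≠ 0 := fun h0 => pow_ne_zero b hvjϖ0 (hYb.symm.trans (by rw [h0, Valuation.map_zero]))
  have hρY0 : ρ Y ≠ 0 := (map_ne_zero ρ).2 hY0
  -- Gram-primitivity read as a STRICT lower bound on `|Y − ρY|`
  have hYρ : Valued.v (cc * (α - ρ α)) * Valued.v (jE ϖ) < Valued.v (Y - ρ Y) := by
    by_contra hle
    push Not at hle
    apply hYprim
    refine ⟨?_, ?_⟩
    · rw [Valuation.map_div, hYb, div_le_one₀ hvjϖpos]
      calc Valued.v (jE ϖ) ^ b ≤ Valued.v (jE ϖ) ^ 1 := pow_le_pow_right_of_le_one' hjϖle hb1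
        _ = Valued.v (jE ϖ) := pow_one _
    · have e : Y / jE ϖ - ρ (Y / jE ϖ) = (Y - ρ Y) / jE ϖ := by
        rw [map_div₀, hρϖ]
        field_simp
      rw [e, Valuation.map_div, div_le_iff₀ hvjϖpos]
      exact hle
  -- coordinates over `Fix ρ`
  set B : M := (μ - ρ μ) / (α - ρ α) with hBdef
  set Q : M := (Y - ρ Y) / (α - ρ α) with hQdef
  set A : M := μ - B * α with hAdef
  set P : M := Y - Q * α with hPdef
  clear_value A P B Q
  have hvB : Valued.v B ≤ Valued.v cc * Valued.v (jE ϖ) ^ (b + 1) := by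
    rw [hBdef, Valuation.map_div, div_le_iff₀ hvαpos]
    calc Valued.v (μ - ρ μ) ≤ Valued.v (cc * (α - ρ α)) * Valued.v (jE ϖ) ^ (b + 1) := hanti
      _ = Valued.v cc * Valued.v (jE ϖ) ^ (b + 1) * Valued.v (α - ρ α) := by rw [Valuation.map_mul]; ac_rfl
  have hvQlo : Valued.v cc * Valued.v (jE ϖ) < Valued.v Q := by
    rw [hQdef, Valuation.map_div, lt_div_iff₀ hvαpos]
    calc Valued.v cc * Valued.v (jE ϖ) * Valued.v (α - ρ α) = Valued.v (cc * (α - ρ α)) * Valued.v (jE ϖ) := by rw [Valuation.map_mul]; ac_rfl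
      _ < Valued.v (Y - ρ Y) := hYρ
  have hvQ : Valued.v Q ≤ Valued.v cc := by rw [hQdef, Valuation.map_div, div_le_iff₀ hvαpos, ← Valuation.map_mul]; exact hYO.2
  have hvP : Valued.v P ≤ Valued.v (jE ϖ) ^ b := by
    rw [hPdef]; refine (Valuation.map_sub _ _ _).trans (max_le hYb.le ?_); rw [Valuation.map_mul]
    exact (mul_le_mul' hvQ hα1).trans (by rw [mul_one]; exact hcb)
  -- `|A| = |ϖE|^{2b}` exactly: `|Bα| ≤ |cc|·|ϖE|^{b+1} ≤ |ϖE|^{2b+1} < |μ|`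
  have hvBα : Valued.v (B * α) < Valued.v μ := by
    rw [Valuation.map_mul, hμ]
    calc Valued.v B * Valued.v α ≤ Valued.v cc * Valued.v (jE ϖ) ^ (b + 1) * 1 := mul_le_mul' hvB hα1
      _ ≤ Valued.v (jE ϖ) ^ b * Valued.v (jE ϖ) ^ (b + 1) := by rw [mul_one]; exact mul_le_mul_left hcb _
      _ = Valued.v (jE ϖ) ^ (2 * b + 1) := by rw [← pow_add]; congr 1; omega
      _ < Valued.v (jE ϖ) ^ (2 * b) := pow_lt_pow_right_of_lt_one₀ hvjϖpos hjϖlt (by omega)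
  have hvA : Valued.v A = Valued.v (jE ϖ) ^ (2 * b) := by rw [hAdef, Valuation.map_sub_eq_of_lt_left _ hvBα, hμ]
  -- `AQ` dominates `BP` strictly
  have hAQlo : Valued.v cc * Valued.v (jE ϖ) ^ (2 * b + 1) < Valued.v (A * Q) := by
    rw [Valuation.map_mul, hvA]
    calc Valued.v cc * Valued.v (jE ϖ) ^ (2 * b + 1) = Valued.v (jE ϖ) ^ (2 * b) * (Valued.v cc * Valued.v (jE ϖ)) := by
          rw [pow_succ]; ac_rfl
      _ < Valued.v (jE ϖ) ^ (2 * b) * Valued.v Q := mul_lt_mul_of_pos_left hvQlo (pow_pos hvjϖpos _)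
  have hBP : Valued.v (B * P) ≤ Valued.v cc * Valued.v (jE ϖ) ^ (2 * b + 1) := by
    rw [Valuation.map_mul]
    calc Valued.v B * Valued.v P ≤ Valued.v cc * Valued.v (jE ϖ) ^ (b + 1) * Valued.v (jE ϖ) ^ b := mul_le_mul' hvB hvP
      _ = Valued.v cc * Valued.v (jE ϖ) ^ (2 * b + 1) := by rw [mul_assoc, ← pow_add]; congr 2; omega
  have hdiff : Valued.v cc * Valued.v (jE ϖ) ^ (2 * b + 1) < Valued.v (B * P - A * Q) := by
    rw [Valuation.map_sub_eq_of_lt_right _ (lt_of_le_of_lt hBP hAQlo)]; exact hAQlo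
  -- the anti-part of `μ∕(ϖE·Y)` is too large
  intro hord
  have hle := hord.2
  have hident : μ / (jE ϖ * Y) - ρ (μ / (jE ϖ * Y)) = (B * P - A * Q) * (α - ρ α) / (jE ϖ * (Y * ρ Y)) := by
    have h1 : μ / (jE ϖ * Y) - ρ (μ / (jE ϖ * Y)) = (μ / Y - ρ (μ / Y)) / jE ϖ := by
      rw [map_div₀, map_div₀, map_mul, hρϖ]
      field_simp
    rw [h1, map_div₀, div_sub_div _ _ hY0 hρY0, mul_map_sub_mul_map_eq hα hBdef hAdef hQdef hPdef]
    field_simp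
  rw [hident, Valuation.map_div, Valuation.map_mul, Valuation.map_mul, Valuation.map_mul, hvρ, hYb,
    div_le_iff₀ (mul_pos hvjϖpos (mul_pos (pow_pos hvjϖpos _) (pow_pos hvjϖpos _)))] at hle
  have hlt : Valued.v (cc * (α - ρ α)) * (Valued.v (jE ϖ) * (Valued.v (jE ϖ) ^ b * Valued.v (jE ϖ) ^ b)) <
      Valued.v (B * P - A * Q) * Valued.v (α - ρ α) := by
    calc Valued.v (cc * (α - ρ α)) * (Valued.v (jE ϖ) * (Valued.v (jE ϖ) ^ b * Valued.v (jE ϖ) ^ b))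
        = Valued.v cc * Valued.v (jE ϖ) ^ (2 * b + 1) * Valued.v (α - ρ α) := by
          rw [Valuation.map_mul, pow_succ, two_mul, pow_add]; ac_rfl
      _ < Valued.v (B * P - A * Q) * Valued.v (α - ρ α) := mul_lt_mul_of_pos_right hdiff hvαpos
  exact absurd (lt_of_lt_of_le hlt hle) (lt_irrefl _)

/-! ## §2 `lam − 1` lies in the order -/

/-- **`lam − 1 ∈ 𝒪_cc` ON THE CELL**: `lam − 1 = μ + (jE u₀₀ − 1)` with `|μ| ≤ 1`, `|u₀₀ − 1| ≤ 1` and `|lam − ρlam| = |μ − ρμ| ≤ |cc(α − ρα)|` (`ρ` fixes `jE u₀₀`).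
[cite: Serre1979, Ch. III §6 Prop. 12] -/
theorem isOrd_sub_one_of_row (jE : E →+* M) (hjv : ∀ c, Valued.v (jE c) ≤ 1 ↔ Valued.v c ≤ 1) (hjfix : ∀ z, ρ z = z ↔ ∃ c, jE c = z)
    {cc lam : M} {u₀ : E} (hu₀ : Valued.v (u₀ - 1) ≤ 1) (hμ : Valued.v (lam - jE u₀) ≤ 1)
    (hanti : Valued.v ((lam - jE u₀) - ρ (lam - jE u₀)) ≤ Valued.v (cc * (α - ρ α))) :
    IsOrd ρ α cc (lam - 1) := by
  have hρu : ρ (jE u₀) = jE u₀ := (hjfix _).2 ⟨_, rfl⟩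
  have hsplit : lam - 1 = (lam - jE u₀) + (jE u₀ - 1) := by ring
  refine ⟨?_, ?_⟩
  · rw [hsplit]
    refine (Valuation.map_add _ _ _).trans (max_le hμ ?_)
    have h := (hjv (u₀ - 1)).2 hu₀
    rwa [map_sub, map_one] at h
  · have e : lam - 1 - ρ (lam - 1) = (lam - jE u₀) - ρ (lam - jE u₀) := by
      rw [map_sub, map_one, map_sub, hρu]; ring
    rw [e]; exact hanti

/-! ## §3 The two square clauses at level `k` -/

/-- **THE SQUARE CLAUSE `(lam − 1)² ∕ ϖE^k ∈ 𝒪_cc`.**  Letters: `|μ| ≤ |ϖE|^{2b}` (`μ = lam − jE u₀₀`), `|μ − ρμ| ≤ |cc(α − ρα)|·|ϖE|^{b+1}`, `|u₀₀ − 1| ≤ |ϖ|^{n_u}`, and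
`k ≤ 2b`, `k ≤ 2n_u`, `k ≤ b + 1 + n_u`: then `|lam − 1| ≤ |ϖE|^{min(2b, n_u)}` and `(lam − 1)² − ρ(lam − 1)² = (lam − ρlam)·((lam − 1) + (ρlam − 1))`.
[cite: Serre1979, Ch. III §6 Prop. 12] [cite: Kottwitz1986BaseChangeUnits, §3] -/
theorem isOrd_sq_div_of_row
    (hvρ : ∀ x, Valued.v (ρ x) = Valued.v x)
    (jE : E →+* M) (hjv : ∀ c, Valued.v (jE c) ≤ 1 ↔ Valued.v c ≤ 1) (hjfix : ∀ z, ρ z = z ↔ ∃ c, jE c = z)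
    {ϖ : E} (hϖ : Valued.v ϖ = exp (-1 : ℤ))
    {cc lam : M} {u₀ : E} {b nu k : ℕ} (hum : Valued.v (u₀ - 1) ≤ Valued.v ϖ ^ nu)
    (hμ : Valued.v (lam - jE u₀) ≤ Valued.v (jE ϖ) ^ (2 * b))
    (hanti : Valued.v ((lam - jE u₀) - ρ (lam - jE u₀)) ≤ Valued.v (cc * (α - ρ α)) * Valued.v (jE ϖ) ^ (b + 1))
    (hk2b : k ≤ 2 * b) (hk2u : k ≤ 2 * nu) (hkbu : k ≤ b + 1 + nu) :
    IsOrd ρ α cc ((lam - 1) ^ 2 / jE ϖ ^ k) := by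
  obtain ⟨hϖ0, hϖlt, hjϖ0, hvjϖ0, hvjϖpos, hjϖlt, hjϖle⟩ := uniformizer_letters jE hjv hϖ
  have hρϖ : ρ (jE ϖ) = jE ϖ := (hjfix _).2 ⟨ϖ, rfl⟩
  have hρu : ρ (jE u₀) = jE u₀ := (hjfix _).2 ⟨_, rfl⟩
  have hjum : Valued.v (jE u₀ - 1) ≤ Valued.v (jE ϖ) ^ nu := by simpa only [map_sub, map_one] using v_map_le_map_pow_of_le jE hjv hϖ0 hum
  have hsplit : lam - 1 = (lam - jE u₀) + (jE u₀ - 1) := by ring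
  -- `|lam − 1| ≤ |ϖE|^e` with `2e ≥ k` and `b + 1 + e ≥ k`
  obtain ⟨e, hl1, hke, hkbe⟩ : ∃ e : ℕ, Valued.v (lam - 1) ≤ Valued.v (jE ϖ) ^ e ∧ k ≤ 2 * e ∧ k ≤ b + 1 + e := by
    rcases le_total (Valued.v (jE ϖ) ^ (2 * b)) (Valued.v (jE ϖ) ^ nu) with hle | hle
    · refine ⟨nu, ?_, hk2u, hkbu⟩
      rw [hsplit]; exact (Valuation.map_add _ _ _).trans (max_le (hμ.trans hle) hjum)
    · refine ⟨2 * b, ?_, by omega, by omega⟩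
      rw [hsplit]; exact (Valuation.map_add _ _ _).trans (max_le hμ (hjum.trans hle))
  have hρl1 : Valued.v (ρ lam - 1) ≤ Valued.v (jE ϖ) ^ e := by rw [show ρ lam - 1 = ρ (lam - 1) by rw [map_sub, map_one], hvρ]; exact hl1
  have hantil : Valued.v (lam - ρ lam) ≤ Valued.v (cc * (α - ρ α)) * Valued.v (jE ϖ) ^ (b + 1) := by
    have e1 : (lam - jE u₀) - ρ (lam - jE u₀) = lam - ρ lam := by rw [map_sub, hρu]; ring
    rw [← e1]; exact hanti
  refine ⟨?_, ?_⟩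
  · rw [Valuation.map_div, Valuation.map_pow, Valuation.map_pow, div_le_one₀ (pow_pos hvjϖpos _)]
    calc Valued.v (lam - 1) ^ 2 ≤ (Valued.v (jE ϖ) ^ e) ^ 2 := pow_le_pow_left₀ zero_le hl1 2
      _ = Valued.v (jE ϖ) ^ (2 * e) := by rw [← pow_mul, mul_comm]
      _ ≤ Valued.v (jE ϖ) ^ k := pow_le_pow_right_of_le_one' hjϖle hke
  · have hid : (lam - 1) ^ 2 / jE ϖ ^ k - ρ ((lam - 1) ^ 2 / jE ϖ ^ k) = (lam - ρ lam) * ((lam - 1) + (ρ lam - 1)) / jE ϖ ^ k := by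
      rw [map_div₀, map_pow, map_pow, hρϖ, map_sub, map_one]
      field_simp
      ring
    rw [hid, Valuation.map_div, Valuation.map_pow, Valuation.map_mul, div_le_iff₀ (pow_pos hvjϖpos _)]
    have htr : Valued.v ((lam - 1) + (ρ lam - 1)) ≤ Valued.v (jE ϖ) ^ e := (Valuation.map_add _ _ _).trans (max_le hl1 hρl1)
    calc Valued.v (lam - ρ lam) * Valued.v ((lam - 1) + (ρ lam - 1))
        ≤ Valued.v (cc * (α - ρ α)) * Valued.v (jE ϖ) ^ (b + 1) * Valued.v (jE ϖ) ^ e := mul_le_mul' hantil htr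
      _ = Valued.v (cc * (α - ρ α)) * Valued.v (jE ϖ) ^ (b + 1 + e) := by rw [mul_assoc, ← pow_add]
      _ ≤ Valued.v (cc * (α - ρ α)) * Valued.v (jE ϖ) ^ k := mul_le_mul_right (pow_le_pow_right_of_le_one' hjϖle hkbe) _

/-- **THE SQUARE CLAUSE `((lam − 1)² − (jE u₀₀ − 1)²) ∕ (ϖE^k·Y) ∈ 𝒪_cc`.**  CELL: `Y ∈ 𝒪_cc`, `|Y| = |ϖE|^b`; letters `|μ| ≤ |ϖE|^{2b}`, `|μ − ρμ| ≤ |cc(α − ρα)|·|ϖE|^{b+1}`,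
`|u₀₀ − 1| ≤ |ϖ|^{n_u}`, `|2| ≤ |ϖ|^t`, and `k ≤ 2b`, `k ≤ t + n_u`: the numerator is `μ·w`, `w = μ + 2(jE u₀₀ − 1)`, `|w| ≤ |ϖE|^k`, `w − ρw = μ − ρμ`.
[cite: Serre1979, Ch. III §6 Prop. 12] [cite: Kottwitz1986BaseChangeUnits, §3] [cite: Jacobowitz1962, §4] -/
theorem isOrd_sqDiff_div_of_row
    (hvρ : ∀ x, Valued.v (ρ x) = Valued.v x)
    (jE : E →+* M) (hjv : ∀ c, Valued.v (jE c) ≤ 1 ↔ Valued.v c ≤ 1) (hjfix : ∀ z, ρ z = z ↔ ∃ c, jE c = z)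
    {ϖ : E} (hϖ : Valued.v ϖ = exp (-1 : ℤ)) {t : ℕ} (h2 : Valued.v (2 : E) ≤ Valued.v ϖ ^ t)
    {cc Y : M} (hYO : IsOrd ρ α cc Y) {b : ℕ} (hYb : Valued.v Y = Valued.v (jE ϖ) ^ b)
    {lam : M} {u₀ : E} {nu k : ℕ} (hum : Valued.v (u₀ - 1) ≤ Valued.v ϖ ^ nu)
    (hμ : Valued.v (lam - jE u₀) ≤ Valued.v (jE ϖ) ^ (2 * b))
    (hanti : Valued.v ((lam - jE u₀) - ρ (lam - jE u₀)) ≤ Valued.v (cc * (α - ρ α)) * Valued.v (jE ϖ) ^ (b + 1))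
    (hk2b : k ≤ 2 * b) (hktu : k ≤ t + nu) :
    IsOrd ρ α cc (((lam - 1) ^ 2 - (jE u₀ - 1) ^ 2) / (jE ϖ ^ k * Y)) := by
  obtain ⟨hϖ0, hϖlt, hjϖ0, hvjϖ0, hvjϖpos, hjϖlt, hjϖle⟩ := uniformizer_letters jE hjv hϖ
  have hρϖ : ρ (jE ϖ) = jE ϖ := (hjfix _).2 ⟨ϖ, rfl⟩
  have hρu : ρ (jE u₀) = jE u₀ := (hjfix _).2 ⟨_, rfl⟩
  have hY0 : Y ≠ 0 := fun h0 => pow_ne_zero b hvjϖ0 (hYb.symm.trans (by rw [h0, Valuation.map_zero]))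
  have hρY0 : ρ Y ≠ 0 := (map_ne_zero ρ).2 hY0
  -- the numerator `μ·w`
  set μ : M := lam - jE u₀ with hμdef
  set w : M := μ + 2 * (jE u₀ - 1) with hwdef
  have hnum : (lam - 1) ^ 2 - (jE u₀ - 1) ^ 2 = μ * w := by rw [hwdef, hμdef]; ring
  have h2u : Valued.v (2 * (jE u₀ - 1)) ≤ Valued.v (jE ϖ) ^ (t + nu) := by
    have h := v_map_le_map_pow_of_le jE hjv hϖ0 (x := 2 * (u₀ - 1)) (m := t + nu)
      (by rw [Valuation.map_mul, pow_add]; exact mul_le_mul' h2 hum)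
    rwa [map_mul, map_sub, map_one, map_ofNat] at h
  have hvw : Valued.v w ≤ Valued.v (jE ϖ) ^ k := by
    rw [hwdef]
    refine (Valuation.map_add _ _ _).trans (max_le ?_ ?_)
    · exact hμ.trans (pow_le_pow_right_of_le_one' hjϖle hk2b)
    · exact h2u.trans (pow_le_pow_right_of_le_one' hjϖle hktu)
  have hwρ : w - ρ w = μ - ρ μ := by
    simp only [hwdef, hμdef, map_add, map_sub, map_mul, map_ofNat, map_one, hρu]; ring
  refine ⟨?_, ?_⟩
  · rw [hnum, Valuation.map_div, Valuation.map_mul, Valuation.map_mul, Valuation.map_pow, hYb,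
      div_le_one₀ (mul_pos (pow_pos hvjϖpos _) (pow_pos hvjϖpos _))]
    calc Valued.v μ * Valued.v w ≤ Valued.v (jE ϖ) ^ (2 * b) * Valued.v (jE ϖ) ^ k := mul_le_mul' hμ hvw
      _ ≤ Valued.v (jE ϖ) ^ b * Valued.v (jE ϖ) ^ k := mul_le_mul_left (pow_le_pow_right_of_le_one' hjϖle (by omega)) _
      _ = Valued.v (jE ϖ) ^ k * Valued.v (jE ϖ) ^ b := mul_comm _ _
  · -- `μw∕(ϖ^kY) − ρ(…) = (μw·ρY − ρ(μw)·Y)∕(ϖ^k·Y·ρY)` and `μw·ρY − ρ(μw)·Y = μw·(ρY − Y) + (μ(w − ρw) + (μ − ρμ)ρw)·Y`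
    have hid : μ * w / (jE ϖ ^ k * Y) - ρ (μ * w / (jE ϖ ^ k * Y)) =
        (μ * w * (ρ Y - Y) + (μ * (w - ρ w) + (μ - ρ μ) * ρ w) * Y) / (jE ϖ ^ k * (Y * ρ Y)) := by
      rw [map_div₀, map_mul, map_mul, map_pow, hρϖ]
      field_simp
      ring
    rw [hnum, hid, Valuation.map_div, Valuation.map_mul, Valuation.map_mul, Valuation.map_pow, hvρ, hYb,
      div_le_iff₀ (mul_pos (pow_pos hvjϖpos _) (mul_pos (pow_pos hvjϖpos _) (pow_pos hvjϖpos _)))]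
    have hρYsub : Valued.v (ρ Y - Y) ≤ Valued.v (cc * (α - ρ α)) := by
      rw [← Valuation.map_neg, neg_sub]; exact hYO.2
    have hA : Valued.v (μ * w * (ρ Y - Y)) ≤ Valued.v (jE ϖ) ^ (2 * b) * Valued.v (jE ϖ) ^ k * Valued.v (cc * (α - ρ α)) := by
      rw [Valuation.map_mul, Valuation.map_mul]
      exact mul_le_mul' (mul_le_mul' hμ hvw) hρYsub
    have hB : Valued.v ((μ * (w - ρ w) + (μ - ρ μ) * ρ w) * Y) ≤
        Valued.v (cc * (α - ρ α)) * Valued.v (jE ϖ) ^ (b + 1) * Valued.v (jE ϖ) ^ k * Valued.v (jE ϖ) ^ b := by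
      rw [Valuation.map_mul, hYb]
      refine mul_le_mul_left ((Valuation.map_add _ _ _).trans (max_le ?_ ?_)) _
      · rw [hwρ, Valuation.map_mul, mul_comm]
        calc Valued.v (μ - ρ μ) * Valued.v μ ≤ Valued.v (cc * (α - ρ α)) * Valued.v (jE ϖ) ^ (b + 1) * Valued.v (jE ϖ) ^ (2 * b) := mul_le_mul' hanti hμ
          _ ≤ Valued.v (cc * (α - ρ α)) * Valued.v (jE ϖ) ^ (b + 1) * Valued.v (jE ϖ) ^ k :=
              mul_le_mul_right (pow_le_pow_right_of_le_one' hjϖle hk2b) _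
      · rw [Valuation.map_mul, hvρ]
        exact mul_le_mul' hanti hvw
    calc Valued.v (μ * w * (ρ Y - Y) + (μ * (w - ρ w) + (μ - ρ μ) * ρ w) * Y)
        ≤ max (Valued.v (jE ϖ) ^ (2 * b) * Valued.v (jE ϖ) ^ k * Valued.v (cc * (α - ρ α)))
            (Valued.v (cc * (α - ρ α)) * Valued.v (jE ϖ) ^ (b + 1) * Valued.v (jE ϖ) ^ k * Valued.v (jE ϖ) ^ b) :=
          (Valuation.map_add _ _ _).trans (max_le_max hA hB)
      _ ≤ Valued.v (cc * (α - ρ α)) * (Valued.v (jE ϖ) ^ k * (Valued.v (jE ϖ) ^ b * Valued.v (jE ϖ) ^ b)) := by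
          refine max_le ?_ ?_
          · rw [show Valued.v (jE ϖ) ^ (2 * b) * Valued.v (jE ϖ) ^ k * Valued.v (cc * (α - ρ α)) =
                Valued.v (cc * (α - ρ α)) * (Valued.v (jE ϖ) ^ k * (Valued.v (jE ϖ) ^ b * Valued.v (jE ϖ) ^ b)) by rw [two_mul, pow_add]; ac_rfl]
          · rw [show Valued.v (cc * (α - ρ α)) * Valued.v (jE ϖ) ^ (b + 1) * Valued.v (jE ϖ) ^ k * Valued.v (jE ϖ) ^ b =
                Valued.v (cc * (α - ρ α)) * (Valued.v (jE ϖ) ^ k * (Valued.v (jE ϖ) ^ b * Valued.v (jE ϖ) ^ b)) * Valued.v (jE ϖ) by rw [pow_succ]; ac_rfl]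
            exact mul_le_of_le_one_right' hjϖle

/-! ## §4 HEAD — a row vertex strictly inside the anti-diagonal is on the `(0, k)`-shell -/

/-- **HEAD — «A ROW VERTEX IS ON THE `ℓ₀ = 0` SHELL» (any `q`).**  Frame: ★ `…ShellLineModel.latticeNearTransvShell_endoGL_sub_one_iff_isOrd`'s glued-vertex letters VERBATIM
(plane `E`, `|ϖ| = exp(−1)`, line model `(M, jE, ρ, α; φ, lam)` with `Fix ρ ⊇ jE(E)` (`hjfix`), vertex `L` with tube `b` over `(B₂, w₀, g₀)`, `Λ = φ(B₂) = x₀·𝒪_cc`, `φ w₀ = Y⁻¹x₀`);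
CELL `hYO hYprim hYb hcb` (`cc = ϖE^j`, `j ≥ b ≥ 1`, Gram-primitive); the literal's `hum : |u₀₀ − 1| ≤ |ϖ|^{n_u}`, `|2| ≤ |ϖ|^t`; ROW letters `hμ : |lam − jE u₀₀| = |ϖE|^{2b}`
(`2b = m`) and `hanti : |μ − ρμ| ≤ |cc(α − ρα)|·|ϖE|^{b+1}` (`j + b + 1 ≤ jl`); square level `k` with `k ≤ 2b`, `k ≤ 2n_u`, `k ≤ b + 1 + n_u`, `k ≤ t + n_u`.
THEN `LatticeNearTransvShell ϖ 0 k (Γ − 1) L`, `Γ = endoGL (γ₂, u)`: `(Γ − 1)L ⊆ L`, `(Γ − 1)L ⊄ ϖL`, `(Γ − 1)²L ⊆ ϖ^k L`.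
[cite: Kottwitz1986BaseChangeUnits, §3] [cite: Serre1979, Ch. III §6 Prop. 12] [cite: Jacobowitz1962, §4] [cite: Rogawski1990, §4.9 Prop. 4.9.1 (b) p. 55] -/
theorem latticeNearTransvShell_zero_of_row
    (hvρ : ∀ x, Valued.v (ρ x) = Valued.v x) (hα : ρ α ≠ α) (hα1 : Valued.v α ≤ 1)
    {ϖ : E} (hϖ : Valued.v ϖ = exp (-1 : ℤ)) {t : ℕ} (h2 : Valued.v (2 : E) ≤ Valued.v ϖ ^ t)
    (jE : E →+* M) (hjv : ∀ c, Valued.v (jE c) ≤ 1 ↔ Valued.v c ≤ 1) (hjfix : ∀ z, ρ z = z ↔ ∃ c, jE c = z)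
    (φ : (Fin 2 → E) →+ M) (hφs : ∀ (c : E) (x : Fin 2 → E), φ (c • x) = jE c * φ x) (hφi : Function.Injective φ)
    {γ₂ : GL (Fin 2) E} {lam : M} (hφγ : ∀ x, φ ((γ₂ : Matrix (Fin 2) (Fin 2) E) *ᵥ x) = lam * φ x)
    {L : Submodule 𝒪[E] (Fin 3 → E)} {b : ℕ} (hb : ∀ a : E, (Pi.single 1 a : Fin 3 → E) ∈ L ↔ Valued.v a ≤ Valued.v ϖ ^ b)
    (hpr : ∀ x ∈ L, Valued.v (x 1) * Valued.v ϖ ^ b ≤ 1)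
    {B₂ : Submodule 𝒪[E] (Fin 2 → E)} {w₀ : Fin 2 → E} {g₀ : Fin 3 → E}
    (hB : B₂.map ((Matrix.toLin' (!![1, 0; 0, 0; 0, 1] : Matrix (Fin 3) (Fin 2) E)).restrictScalars 𝒪[E]) =
      L ⊓ LinearMap.ker ((LinearMap.proj (1 : Fin 3) : (Fin 3 → E) →ₗ[E] E).restrictScalars 𝒪[E]))
    (hg₀ : g₀ ∈ L) (hg₀1 : Valued.v (g₀ 1) * Valued.v ϖ ^ b = 1) (hprg : g₀ - Pi.single 1 (g₀ 1) = ![w₀ 0, 0, w₀ 1])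
    {Λ : AddSubgroup M} (hBΛ : B₂.toAddSubgroup.map φ = Λ) {cc x₀ Y : M} (hx₀ : x₀ ≠ 0)
    (hΛx : ∀ x, x ∈ Λ ↔ ∃ z, IsOrd ρ α cc z ∧ x = x₀ * z) (hw₀Y : φ w₀ = Y⁻¹ * x₀)
    (hYO : IsOrd ρ α cc Y) (hYprim : ¬ IsOrd ρ α cc (Y / jE ϖ)) (hb1 : 1 ≤ b) (hYb : Valued.v Y = Valued.v (jE ϖ) ^ b) (hcb : Valued.v cc ≤ Valued.v (jE ϖ) ^ b)
    (u : GL (Fin 1) E) {nu : ℕ} (hum : Valued.v ((u : Matrix (Fin 1) (Fin 1) E) 0 0 - 1) ≤ Valued.v ϖ ^ nu)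
    (hμ : Valued.v (lam - jE ((u : Matrix (Fin 1) (Fin 1) E) 0 0)) = Valued.v (jE ϖ) ^ (2 * b))
    (hanti : Valued.v ((lam - jE ((u : Matrix (Fin 1) (Fin 1) E) 0 0)) - ρ (lam - jE ((u : Matrix (Fin 1) (Fin 1) E) 0 0))) ≤
      Valued.v (cc * (α - ρ α)) * Valued.v (jE ϖ) ^ (b + 1))
    {k : ℕ} (hk2b : k ≤ 2 * b) (hk2u : k ≤ 2 * nu) (hkbu : k ≤ b + 1 + nu) (hktu : k ≤ t + nu) :
    LatticeNearTransvShell ϖ 0 k ((((endoGL (γ₂, u) : GL (Fin 3) E) : Matrix (Fin 3) (Fin 3) E) - 1)) L := by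
  obtain ⟨hϖ0, hϖlt, hjϖ0, hvjϖ0, hvjϖpos, hjϖlt, hjϖle⟩ := uniformizer_letters jE hjv hϖ
  have hρϖ : ρ (jE ϖ) = jE ϖ := (hjfix _).2 ⟨ϖ, rfl⟩
  have hY0 : Y ≠ 0 := fun h0 => pow_ne_zero b hvjϖ0 (hYb.symm.trans (by rw [h0, Valuation.map_zero]))
  -- letters weakened to the forms the clauses want
  have hu1 : Valued.v ((u : Matrix (Fin 1) (Fin 1) E) 0 0 - 1) ≤ 1 := hum.trans (pow_le_one₀ zero_le hϖlt.le)
  have hμ1 : Valued.v (lam - jE ((u : Matrix (Fin 1) (Fin 1) E) 0 0)) ≤ 1 := hμ.le.trans (pow_le_one₀ zero_le hjϖle)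
  have hantib : Valued.v ((lam - jE ((u : Matrix (Fin 1) (Fin 1) E) 0 0)) - ρ (lam - jE ((u : Matrix (Fin 1) (Fin 1) E) 0 0))) ≤
      Valued.v (cc * (α - ρ α)) * Valued.v (jE ϖ) ^ b :=
    hanti.trans (mul_le_mul_right (pow_le_pow_right_of_le_one' hjϖle (Nat.le_succ b)) _)
  have hanti0 : Valued.v ((lam - jE ((u : Matrix (Fin 1) (Fin 1) E) 0 0)) - ρ (lam - jE ((u : Matrix (Fin 1) (Fin 1) E) 0 0))) ≤
      Valued.v (cc * (α - ρ α)) :=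
    hantib.trans (mul_le_of_le_one_right' (pow_le_one₀ zero_le hjϖle))
  rw [latticeNearTransvShell_endoGL_sub_one_iff_isOrd hvρ hϖ jE φ hφs hφi hφγ hb hpr hB hg₀ hg₀1 hprg hBΛ hx₀ hY0 hΛx hw₀Y u 0 k,
    pow_zero, pow_zero, div_one, one_mul, zero_add, pow_one, pow_one]
  refine ⟨⟨hu1.trans (le_of_eq (Valuation.map_one _).symm), ?_, ?_⟩, ?_, ⟨?_, ?_, ?_⟩⟩
  · exact isOrd_sub_one_of_row (α := α) jE hjv hjfix hu1 hμ1 hanti0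
  · exact isOrd_div_of_row hvρ hα hα1 jE hjv hϖ hYO hYb hcb hμ.le hantib
  · exact fun h => not_isOrd_div_mul_of_row hvρ hα hα1 jE hjv hϖ hρϖ hYO hYprim hb1 hYb hcb hμ hanti h.2.2
  · rw [Valuation.map_pow, Valuation.map_pow]
    calc Valued.v ((u : Matrix (Fin 1) (Fin 1) E) 0 0 - 1) ^ 2 ≤ (Valued.v ϖ ^ nu) ^ 2 := pow_le_pow_left₀ zero_le hum 2
      _ = Valued.v ϖ ^ (2 * nu) := by rw [← pow_mul, mul_comm]
      _ ≤ Valued.v ϖ ^ k := pow_le_pow_right_of_le_one' hϖlt.le hk2u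
  · exact isOrd_sq_div_of_row hvρ jE hjv hjfix hϖ hum hμ.le hanti hk2b hk2u hkbu
  · exact isOrd_sqDiff_div_of_row hvρ jE hjv hjfix hϖ h2 hYO hYb hum hμ.le hanti hk2b hktu

end Summit.HodgeConjecture.HodgeConjecture.Cruxes.H413.F0P3cDyRamRowCellOnShell

end
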